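import Literature.AlgebraicGeometry.Motives.PrymVariety
import Literature.AlgebraicGeometry.Motives.ClosedGraphMorphism
import Literature.NumberTheory.DiophantineGeometry.AVIsogenyQuasiInverse
import HarnessLib

/-!
# A homomorphism of abelian varieties whose kernel has a zero-dimensional identity component has finitely many
# `K`-points in its kernel

Family `hodge`, layer `Literature/AlgebraicGeometry/Motives` (prover seat core-w5 gen 3 of the ring-2 cell, 2026-08-28; requested by road №4
`Summits/HodgeConjecture/HodgeConjecture/Theses/VHCAbelianSchemesRoad.lean`, crux stmt-HodgeConjecture-26512, line `mover-trap`, stub (S2)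
`stub_moverConfinement_of_KSimple` — its k0 memo `Cruxes/DiagLocalOfMarkmanPinnedForall/Lines/MoverTrap-S2-K0.md`, step A4). Everything here is
PROVED; no definition, no named fact.

For a homomorphism `φ : X → Y` of abelian varieties over an algebraically closed field `K`, the tree's `AbelianVariety.kerComponent φ` is the
identity component `(Ker φ)⁰_red` of the kernel (`Motives/PrymVariety`: the maximal irreducible subset `kerComponentCarrier φ` of the fibre
`φ⁻¹(e)` through the origin, an abelian subvariety), and `φ⁻¹(e)` is a FINITE union of its translates
(`kerSet_subset_iUnion_translation_kerComponentCarrier`; Görtz–Wedhorn II, Lemma 27.13: the connected components of a group scheme locally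
of finite type over a field are the translates of `G⁰` by points, finitely many on a quasi-compact one). Hence:

* `kerComponentCarrier_subsingleton_of_dim_eq_zero`, `kerComponentCarrier_eq_singleton_of_dim_eq_zero` — if `dim (Ker φ)⁰_red = 0` the
  carrier is the single point `{e}` (contrapositive of the tree's `dim_redSub_pos`: a closed irreducible subgroup carrier with two points has
  positive dimension);
* `kerSet_finite_of_dim_kerComponent_eq_zero` — then the fibre `φ⁻¹(e) ⊆ X` is a finite set of scheme points;
* `kerPoints_finite_of_dim_kerComponent_eq_zero` — and the kernel on `K`-points `Ker φ (K) ≤ X(K)` (`Hom.kerPoints (specOver K K) φ`) is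
  finite (a `K`-point is determined by its closed point, `AlgPoints.eq_of_pt_eq`; membership `left_closedPoint_mem_kerSet_iff`).

This is the elementary half of «`Ker φ` is finite iff `dim (Ker φ)⁰ = 0`» (Görtz–Wedhorn II, Prop. 27.176 / Milne 1986 §8 for isogenies); the
converse is not needed by the consumer and not proved.

References: [cite: GortzWedhorn2023, Def./Prop. 27.12 and Lemma 27.13 (p. 608)] [cite: MumfordAV1970, §19 (p. 173)] [cite: MilneAV2008, I §8 (p. 36)].
-/

universe u

open CategoryTheory AlgebraicGeometry TopologicalSpace

noncomputable section

namespace Literature.AlgebraicGeometry.Motives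

namespace AbelianVariety

variable {K : Type u} [Field K] [IsAlgClosed K] {X Y : AbelianVariety K} (φ : X ⟶ Y)

/-- If `dim (Ker φ)⁰_red = 0` then the carrier of the identity component has at most one point (the tree's `dim_redSub_pos`: two
distinct points on the irreducible carrier give positive dimension). [cite: GortzWedhorn2023, Def./Prop. 27.12 (p. 608)] -/
theorem kerComponentCarrier_subsingleton_of_dim_eq_zero (h : (kerComponent φ).dim = 0) :
    (kerComponentCarrier φ : Set X.X.left).Subsingleton := by
  by_contra hnt
  rw [Set.not_subsingleton_iff] at hnt
  have hpos : 0 < (kerComponent φ).dim :=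
    dim_redSub_pos (kerComponentCarrier φ) (isIrreducible_kerComponentCarrier φ) (origin_mem_kerComponentCarrier φ)
      (range_divMor_subset_kerComponentCarrier φ) hnt
  omega

/-- If `dim (Ker φ)⁰_red = 0` then the carrier of the identity component is the origin alone. [cite: GortzWedhorn2023, Def./Prop. 27.12 (p. 608)] -/
theorem kerComponentCarrier_eq_singleton_of_dim_eq_zero (h : (kerComponent φ).dim = 0) :
    (kerComponentCarrier φ : Set X.X.left) = {origin X} :=
  (kerComponentCarrier_subsingleton_of_dim_eq_zero φ h).eq_singleton_of_mem (origin_mem_kerComponentCarrier φ)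

/-- **If `dim (Ker φ)⁰_red = 0` the fibre `φ⁻¹(e)` is a finite set of points of `X`**: it is a finite union of translates of the one-point
carrier `(Ker φ)⁰`. [cite: GortzWedhorn2023, Lemma 27.13 (p. 608)] -/
theorem kerSet_finite_of_dim_kerComponent_eq_zero (h : (kerComponent φ).dim = 0) : (kerSet φ).Finite := by
  obtain ⟨I, hI, Q, -, hcover⟩ := kerSet_subset_iUnion_translation_kerComponentCarrier φ
  refine Set.Finite.subset (Set.finite_iUnion fun i => ?_) hcover
  rw [kerComponentCarrier_eq_singleton_of_dim_eq_zero φ h, Set.image_singleton]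
  exact Set.finite_singleton _

/-- **If `dim (Ker φ)⁰_red = 0` the kernel `Ker φ (K) ≤ X(K)` on `K`-points is finite**: a `K`-point is determined by its closed point, which
lies in the finite fibre `φ⁻¹(e)`. [cite: GortzWedhorn2023, Lemma 27.13 (p. 608)] [cite: MilneAV2008, I §8 (p. 36)] -/
theorem kerPoints_finite_of_dim_kerComponent_eq_zero (h : (kerComponent φ).dim = 0) :
    (Hom.kerPoints (specOver K K) φ : Set (X.Points K)).Finite := by
  have hfin := kerSet_finite_of_dim_kerComponent_eq_zero φ h
  -- the closed point of a `K`-point of the kernel lies in the fibre, injectively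
  refine Set.Finite.of_finite_image (f := fun P : X.Points K => AlgPoints.pt P) (hfin.subset ?_) ?_
  · rintro _ ⟨P, hP, rfl⟩
    exact (left_closedPoint_mem_kerSet_iff φ P).2 ((Hom.mem_kerPoints_iff φ P).1 hP)
  · exact fun P _ P' _ hPP' => AlgPoints.eq_of_pt_eq hPP'

/-- The same, as a `Finite` instance-style statement on the subgroup. [cite: GortzWedhorn2023, Lemma 27.13 (p. 608)] -/
theorem finite_kerPoints_of_dim_kerComponent_eq_zero (h : (kerComponent φ).dim = 0) :
    Finite (Hom.kerPoints (specOver K K) φ) :=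
  (kerPoints_finite_of_dim_kerComponent_eq_zero φ h).to_subtype

end AbelianVariety

end Literature.AlgebraicGeometry.Motives

end
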